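import Literature.AlgebraicGeometry.Motives.HodgeLieCentreTrivialOfTotallyRealCentre
import Literature.AlgebraicGeometry.Motives.HodgeLieReductiveAnyWeight
import HarnessLib

/-!
# `𝔷(𝔥) = 0 ⟹ 𝔥 = [𝔥, 𝔥]` is a semisimple Lie algebra — in weight one: a totally real centre of `End_{HS}` makes
# `Lie Hg(H)` semisimple («no factors of Type 4 ⟹ `Hg(X)` is semi-simple», Moonen–Zarhin 1999 §1)

Family `hodge`, layer `Literature/AlgebraicGeometry/Motives` (pure Hodge structures); THEOREMS ONLY — no definition, no
named fact, no `sorry` (D-0026, net debt 0). Lane `lit-hodgefound` (Track 2 foundations library), prover seat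
`lit-hodgefound-p21`, generation 29, row g29-#10; sequel of g29-#8 `HodgeLieCentreTrivialOfTotallyRealCentre`
(`hodgeLie_inf_endAlg_eq_bot_of_center_totallyReal`, `Polarization.hodgeLie_inf_endAlg_eq_bot_of_forall_center_adjoint_eq`)
and of the tree's `HodgeLieReductiveAnyWeight` (Deligne I Prop. 3.6 for ANY weight: `𝔥 = 𝔷(𝔥) ⊕ [𝔥, 𝔥]`,
`AnyWeight.hodgeLie_center_sup_derived_eq`; `[𝔥, 𝔥]` semisimple, `AnyWeight.isSemisimple_of_eq_hodgeLie_derived`, Killing,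
`AnyWeight.isKilling_of_eq_hodgeLie_derived`).

THE STEP. `𝔥 = Lie Hg(H)` is reductive: `𝔥 = 𝔷 ⊕ [𝔥, 𝔥]` with `𝔷 = 𝔥 ∩ End_{HS}` and `[𝔥, 𝔥]` semisimple (tree). Hence
`𝔷 = 0` gives `𝔥 = [𝔥, 𝔥]` semisimple (Mathlib `LieAlgebra.IsSemisimple ℚ`, on every Lie subalgebra of `𝔤𝔩(V)` with
carrier `𝔥` — one exists, `exists_lieSubalgebra_toSubmodule_eq_hodgeLie`), with non-degenerate Killing form. By g29-#8,
`𝔷 = 0` holds when the polarization involution fixes the centre of `End_{HS}` pointwise, in particular (weight one) when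
that centre is totally real: Moonen–Zarhin 1999 §1 (held `paper:arxiv-math_9901113` p0002 L134–136) «If `X` has no factors
of Type 4 then `Hg(X)` is semi-simple».

MAIN RESULTS (all proved):
* §1 (`𝔷 = 0`, any weight) `exists_lieSubalgebra_toSubmodule_eq_hodgeLie`, **`hodgeLie_eq_derived_of_center_eq_bot`**
  (`𝔥 = [𝔥, 𝔥]`), **`isSemisimple_hodgeLie_of_center_eq_bot`**, `hasTrivialRadical_hodgeLie_of_center_eq_bot`,
  `isKilling_hodgeLie_of_center_eq_bot`, `eq_zero_of_mem_hodgeLie_of_forall_commute_of_center_eq_bot`.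
* §2 (`†` fixes the centre of `End_{HS}`, any weight) `Polarization.hodgeLie_eq_derived_of_forall_center_adjoint_eq`,
  `Polarization.isSemisimple_hodgeLie_of_forall_center_adjoint_eq`.
* §3 (weight one, totally real centre) **`hodgeLie_eq_derived_of_center_totallyReal`**,
  **`isSemisimple_hodgeLie_of_center_totallyReal`** (Moonen–Zarhin's sentence), `isKilling_hodgeLie_of_center_totallyReal`,
  `hasTrivialRadical_hodgeLie_of_center_totallyReal`.

## References

* [MoonenZarhin1999LowDim] B. Moonen, Yu. Zarhin, *Hodge classes on abelian varieties of low dimension*, Math. Ann. 315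
  (1999), §1. [cite: MoonenZarhin1999LowDim, §1]
* [Deligne1982HodgeCycles] P. Deligne, *Hodge cycles on abelian varieties*, LNM 900 (1982), I §3 Prop. 3.6.
  [cite: Deligne1982HodgeCycles, I §3 Prop. 3.6]
* [Humphreys1972] J. Humphreys, *Introduction to Lie Algebras and Representation Theory*, §19.1, §5.1.
  [cite: Humphreys1972, §19.1]
-/

noncomputable section

namespace Literature.AlgebraicGeometry.Motives

namespace HodgeStructure

universe u

variable {V : Type u} [AddCommGroup V] [Module ℚ V] [Module.Finite ℚ V] [HodgeTensorFacts.{u, u}] {n : ℤ}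
  {H : HodgeStructure V n}

/-! ### §1 `𝔷(𝔥) = 0 ⟹ 𝔥 = [𝔥, 𝔥]` is semisimple (any weight) -/

omit [Module.Finite ℚ V] [HodgeTensorFacts.{u, u}] in
/-- **`𝔥 = Lie Hg(H)` is (the carrier of) a Lie subalgebra of `𝔤𝔩(V)`** (bracket-closed: tree `commutator_mem_hodgeLie`) —
so the statements below quantified over «every Lie subalgebra with carrier `𝔥`» are not vacuous. [cite: Deligne1982HodgeCycles, I §3 Prop. 3.6]
[cite: Huybrechts2016K3, Thm. 3.3.9] -/
theorem exists_lieSubalgebra_toSubmodule_eq_hodgeLie [Module.Finite ℚ V] [HodgeTensorFacts.{u, u}]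
    (H : HodgeStructure V n) :
    letI : LieRing (Module.End ℚ V) := LieRing.ofAssociativeRing
    ∃ 𝔏 : LieSubalgebra ℚ (Module.End ℚ V), 𝔏.toSubmodule = H.hodgeLie := by
  letI : LieRing (Module.End ℚ V) := LieRing.ofAssociativeRing
  exact ⟨{ H.hodgeLie with
      lie_mem' := fun {X Y} hX hY => by
        rw [LieRing.of_associative_ring_bracket]
        exact commutator_mem_hodgeLie H hX hY }, rfl⟩

/-- **`𝔷(𝔥) = 0 ⟹ 𝔥 = [𝔥, 𝔥]`** (`𝔥 = 𝔷 ⊕ [𝔥, 𝔥]` for a polarizable Hodge structure of any weight, tree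
`AnyWeight.hodgeLie_center_sup_derived_eq`). [cite: Deligne1982HodgeCycles, I §3 Prop. 3.6] [cite: Humphreys1972, §19.1] -/
theorem hodgeLie_eq_derived_of_center_eq_bot (ψ : H.Polarization)
    (h𝔷 : H.hodgeLie ⊓ Subalgebra.toSubmodule H.endAlg = ⊥) :
    Submodule.span ℚ {B | ∃ X ∈ H.hodgeLie, ∃ Y ∈ H.hodgeLie, X * Y - Y * X = B} = H.hodgeLie := by
  have h := AnyWeight.hodgeLie_center_sup_derived_eq H ψ
  rwa [h𝔷, bot_sup_eq] at h

/-- **`𝔷(𝔥) = 0 ⟹ 𝔥` IS A SEMISIMPLE LIE ALGEBRA** (Mathlib `LieAlgebra.IsSemisimple ℚ`, for every Lie subalgebra of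
`𝔤𝔩(V)` with carrier `𝔥`; tree `AnyWeight.isSemisimple_of_eq_hodgeLie_derived` for `[𝔥, 𝔥]`). [cite: Deligne1982HodgeCycles, I §3 Prop. 3.6]
[cite: Humphreys1972, §19.1] -/
theorem isSemisimple_hodgeLie_of_center_eq_bot (ψ : H.Polarization)
    (h𝔷 : H.hodgeLie ⊓ Subalgebra.toSubmodule H.endAlg = ⊥) :
    letI : LieRing (Module.End ℚ V) := LieRing.ofAssociativeRing
    ∀ 𝔏 : LieSubalgebra ℚ (Module.End ℚ V), 𝔏.toSubmodule = H.hodgeLie → LieAlgebra.IsSemisimple ℚ 𝔏 := by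
  letI : LieRing (Module.End ℚ V) := LieRing.ofAssociativeRing
  intro 𝔏 h𝔏
  exact AnyWeight.isSemisimple_of_eq_hodgeLie_derived H ψ 𝔏 (h𝔏.trans (hodgeLie_eq_derived_of_center_eq_bot ψ h𝔷).symm)

/-- `𝔷(𝔥) = 0 ⟹ 𝔥` has trivial radical. [cite: Deligne1982HodgeCycles, I §3 Prop. 3.6] [cite: Humphreys1972, §19.1] -/
theorem hasTrivialRadical_hodgeLie_of_center_eq_bot (ψ : H.Polarization)
    (h𝔷 : H.hodgeLie ⊓ Subalgebra.toSubmodule H.endAlg = ⊥) :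
    letI : LieRing (Module.End ℚ V) := LieRing.ofAssociativeRing
    ∀ 𝔏 : LieSubalgebra ℚ (Module.End ℚ V), 𝔏.toSubmodule = H.hodgeLie → LieAlgebra.HasTrivialRadical ℚ 𝔏 := by
  letI : LieRing (Module.End ℚ V) := LieRing.ofAssociativeRing
  intro 𝔏 h𝔏
  exact AnyWeight.hasTrivialRadical_of_eq_hodgeLie_derived H ψ 𝔏 (h𝔏.trans (hodgeLie_eq_derived_of_center_eq_bot ψ h𝔷).symm)

/-- `𝔷(𝔥) = 0 ⟹` the Killing form of `𝔥` is non-degenerate. [cite: Humphreys1972, §5.1] [cite: Deligne1982HodgeCycles, I §3 Prop. 3.6] -/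
theorem isKilling_hodgeLie_of_center_eq_bot (ψ : H.Polarization)
    (h𝔷 : H.hodgeLie ⊓ Subalgebra.toSubmodule H.endAlg = ⊥) :
    letI : LieRing (Module.End ℚ V) := LieRing.ofAssociativeRing
    ∀ 𝔏 : LieSubalgebra ℚ (Module.End ℚ V), 𝔏.toSubmodule = H.hodgeLie → LieAlgebra.IsKilling ℚ 𝔏 := by
  letI : LieRing (Module.End ℚ V) := LieRing.ofAssociativeRing
  intro 𝔏 h𝔏
  exact AnyWeight.isKilling_of_eq_hodgeLie_derived H ψ 𝔏 (h𝔏.trans (hodgeLie_eq_derived_of_center_eq_bot ψ h𝔷).symm)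

/-- `𝔷(𝔥) = 0`, literally: every element of `𝔥` commuting with `𝔥` is `0` (`End_{HS}` is the commutant of `𝔥`, g29-#8
`mem_endAlg_iff_forall_commute_hodgeLie`). [cite: Deligne1982HodgeCycles, I §3 Prop. 3.6] -/
theorem eq_zero_of_mem_hodgeLie_of_forall_commute_of_center_eq_bot
    (h𝔷 : H.hodgeLie ⊓ Subalgebra.toSubmodule H.endAlg = ⊥) {z : Module.End ℚ V} (hz : z ∈ H.hodgeLie)
    (hc : ∀ X ∈ H.hodgeLie, z * X = X * z) : z = 0 := by
  have h : z ∈ H.hodgeLie ⊓ Subalgebra.toSubmodule H.endAlg :=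
    Submodule.mem_inf.2 ⟨hz, mem_endAlg_of_forall_commute H hc⟩
  rwa [h𝔷, Submodule.mem_bot] at h

/-! ### §2 `†` fixes the centre of `End_{HS}` (any weight) -/

/-- **`†` fixes the centre of `End_{HS}(H)` ⟹ `𝔥 = [𝔥, 𝔥]`.** [cite: Deligne1982HodgeCycles, I §3 Prop. 3.6] [cite: MoonenZarhin1999LowDim, §1] -/
theorem Polarization.hodgeLie_eq_derived_of_forall_center_adjoint_eq (ψ : H.Polarization)
    (hfix : ∀ a ∈ H.endAlg, (∀ b ∈ H.endAlg, a * b = b * a) → ψ.adjoint a = a) :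
    Submodule.span ℚ {B | ∃ X ∈ H.hodgeLie, ∃ Y ∈ H.hodgeLie, X * Y - Y * X = B} = H.hodgeLie :=
  hodgeLie_eq_derived_of_center_eq_bot ψ (ψ.hodgeLie_inf_endAlg_eq_bot_of_forall_center_adjoint_eq hfix)

/-- **`†` fixes the centre of `End_{HS}(H)` ⟹ `𝔥` is semisimple.** [cite: Deligne1982HodgeCycles, I §3 Prop. 3.6]
[cite: MoonenZarhin1999LowDim, §1] -/
theorem Polarization.isSemisimple_hodgeLie_of_forall_center_adjoint_eq (ψ : H.Polarization)
    (hfix : ∀ a ∈ H.endAlg, (∀ b ∈ H.endAlg, a * b = b * a) → ψ.adjoint a = a) :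
    letI : LieRing (Module.End ℚ V) := LieRing.ofAssociativeRing
    ∀ 𝔏 : LieSubalgebra ℚ (Module.End ℚ V), 𝔏.toSubmodule = H.hodgeLie → LieAlgebra.IsSemisimple ℚ 𝔏 :=
  isSemisimple_hodgeLie_of_center_eq_bot ψ (ψ.hodgeLie_inf_endAlg_eq_bot_of_forall_center_adjoint_eq hfix)

/-! ### §3 Weight one: totally real centre of `End_{HS}` («no factors of Type 4 ⟹ `Hg` semi-simple») -/

/-- **Weight one, totally real centre of `End_{HS}(H)` ⟹ `𝔥 = [𝔥, 𝔥]`.** [cite: MoonenZarhin1999LowDim, §1]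
[cite: Deligne1982HodgeCycles, I §3 Prop. 3.6] -/
theorem hodgeLie_eq_derived_of_center_totallyReal (hn : n = 1) (heff : H.IsEffective) (ψ : H.Polarization)
    (hZ : ∀ a ∈ H.endAlg, (∀ b ∈ H.endAlg, a * b = b * a) →
      ∃ f : Polynomial ℚ, f ≠ 0 ∧ Polynomial.aeval a f = 0 ∧ ∀ z : ℂ, Polynomial.aeval z f = 0 → z.im = 0) :
    Submodule.span ℚ {B | ∃ X ∈ H.hodgeLie, ∃ Y ∈ H.hodgeLie, X * Y - Y * X = B} = H.hodgeLie :=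
  hodgeLie_eq_derived_of_center_eq_bot ψ (hodgeLie_inf_endAlg_eq_bot_of_center_totallyReal hn heff ψ hZ)

/-- **«IF `X` HAS NO FACTORS OF TYPE 4 THEN `Hg(X)` IS SEMI-SIMPLE»** (Moonen–Zarhin 1999 §1), for a polarized effective
Hodge structure of weight one whose `End_{HS}` has totally real centre: `𝔥 = Lie Hg(H)` is a semisimple Lie algebra
(Mathlib `LieAlgebra.IsSemisimple ℚ`, for every Lie subalgebra of `𝔤𝔩(V)` with carrier `𝔥`).
[cite: MoonenZarhin1999LowDim, §1] [cite: Deligne1982HodgeCycles, I §3 Prop. 3.6] -/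
theorem isSemisimple_hodgeLie_of_center_totallyReal (hn : n = 1) (heff : H.IsEffective) (ψ : H.Polarization)
    (hZ : ∀ a ∈ H.endAlg, (∀ b ∈ H.endAlg, a * b = b * a) →
      ∃ f : Polynomial ℚ, f ≠ 0 ∧ Polynomial.aeval a f = 0 ∧ ∀ z : ℂ, Polynomial.aeval z f = 0 → z.im = 0) :
    letI : LieRing (Module.End ℚ V) := LieRing.ofAssociativeRing
    ∀ 𝔏 : LieSubalgebra ℚ (Module.End ℚ V), 𝔏.toSubmodule = H.hodgeLie → LieAlgebra.IsSemisimple ℚ 𝔏 :=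
  isSemisimple_hodgeLie_of_center_eq_bot ψ (hodgeLie_inf_endAlg_eq_bot_of_center_totallyReal hn heff ψ hZ)

/-- … with trivial radical. [cite: MoonenZarhin1999LowDim, §1] [cite: Deligne1982HodgeCycles, I §3 Prop. 3.6] -/
theorem hasTrivialRadical_hodgeLie_of_center_totallyReal (hn : n = 1) (heff : H.IsEffective) (ψ : H.Polarization)
    (hZ : ∀ a ∈ H.endAlg, (∀ b ∈ H.endAlg, a * b = b * a) →
      ∃ f : Polynomial ℚ, f ≠ 0 ∧ Polynomial.aeval a f = 0 ∧ ∀ z : ℂ, Polynomial.aeval z f = 0 → z.im = 0) :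
    letI : LieRing (Module.End ℚ V) := LieRing.ofAssociativeRing
    ∀ 𝔏 : LieSubalgebra ℚ (Module.End ℚ V), 𝔏.toSubmodule = H.hodgeLie → LieAlgebra.HasTrivialRadical ℚ 𝔏 :=
  hasTrivialRadical_hodgeLie_of_center_eq_bot ψ (hodgeLie_inf_endAlg_eq_bot_of_center_totallyReal hn heff ψ hZ)

/-- … and with non-degenerate Killing form. [cite: MoonenZarhin1999LowDim, §1] [cite: Humphreys1972, §5.1] -/
theorem isKilling_hodgeLie_of_center_totallyReal (hn : n = 1) (heff : H.IsEffective) (ψ : H.Polarization)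
    (hZ : ∀ a ∈ H.endAlg, (∀ b ∈ H.endAlg, a * b = b * a) →
      ∃ f : Polynomial ℚ, f ≠ 0 ∧ Polynomial.aeval a f = 0 ∧ ∀ z : ℂ, Polynomial.aeval z f = 0 → z.im = 0) :
    letI : LieRing (Module.End ℚ V) := LieRing.ofAssociativeRing
    ∀ 𝔏 : LieSubalgebra ℚ (Module.End ℚ V), 𝔏.toSubmodule = H.hodgeLie → LieAlgebra.IsKilling ℚ 𝔏 :=
  isKilling_hodgeLie_of_center_eq_bot ψ (hodgeLie_inf_endAlg_eq_bot_of_center_totallyReal hn heff ψ hZ)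

end HodgeStructure

end Literature.AlgebraicGeometry.Motives
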